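import Literature.Analysis.OperatorTheory.Enflo2023.CaseIIFactor
import Literature.Analysis.OperatorTheory.Enflo2023.Lemma2
import HarnessLib

/-!
# Enflo (2023), Part A p.13: the factor `(εθ)' < (1 − 1/20)εθ` HOLDS whenever Case II (as printed) holds twice

Source under adjudication: Per H. Enflo, *On the invariant subspace problem in Hilbert spaces*, arXiv:2305.15442
(v2, 2024), bib key `Enflo2023`.  [cite: Enflo2023, v2 p.12, Case II (tex L400): "`|⟨T^j y₁', x₀ − y₁'⟩| < (εθ)⁴`
for all `j`"; p.13, eq. (26)–(27) and tex L421–L431: "Equation (27) gives `⟨ℓ'(T)y₁', x₀ − ℓ'(T)y₁'⟩ <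
εθ(1 − 1/20)` … Thus, every time we apply Lemma 2 we either get Case I and we are done, or we get Case II and pass
to a smaller `εθ`, diminished by a factor `(1 − 1/20)` … So, if Case II happens every time we obtain convergence
to a non-cyclic vector."]

This module is os-F3b / BLOCK-2b repair-cell work (`pub-enflo`): a kernel-checked statement ABOUT one step of
the manuscript (formaliser 1, Part A).  NOTHING here asserts the manuscript's main theorem; no declaration
concludes the invariant subspace problem for an arbitrary operator.

WHAT IS PROVED (the text's own, approximate Case II; all constants the text's: `‖T‖ = 10⁻²⁰`, `δ = εθ/10`).
Let `‖x₀‖ = 1`, `⟨x₀ − y, y⟩ = εθ ∈ (0, 10⁻⁴]`, `‖x₀ − y‖ ≤ 0.7`, let `a` be THE minimiser of (26) and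
`y' = ℓ'(T)y = V_y a`, `(εθ)' = ⟨x₀ − y', y'⟩` (real, `= C'‖a‖²` by (6)).  If Case II AS PRINTED holds at `y`
(`|⟨x₀ − y, T^j y⟩| ≤ (εθ)⁴`, `j ≥ 1`) AND at `y'` (`|⟨x₀ − y', T^j y'⟩| ≤ ((εθ)')⁴`, `j ≥ 1`), then
`(εθ)' ≤ 0.9491·εθ < (1 − 1/20)εθ` (`CaseII.factor_of_caseII_twice`).  Consequently, on the branch "Case II
happens every time" the factor holds at EVERY stage with `εθ > 0` (a stage with `εθ = 0` is orthogonal to the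
whole orbit outright), the iteration contracts, and — by the convergence theorem `CaseII.crun_limit` behind
`CaseII.hasNontrivialClosedInvariantSubspace_of_contraction_along_runs` (rows A26) — `T` has a non-trivial closed
invariant subspace (`CaseII.hasNontrivialClosedInvariantSubspace_of_caseII_along_runs`; hypotheses: `‖T‖ ≤ 10⁻²⁰`,
`‖x₀‖ = 1`, `0.3 ≤ ‖x₀ − y₀‖ ≤ 0.7`, `(εθ)₀ ∈ [0, 10⁻⁴]` real, Case II as printed at every stage of every run of
(26) from `y₀`; NO contraction hypothesis).  So the CONCLUSION of the text's Case II branch (tex L429) is TRUE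
although its stated route is not: (27) is false for the minimiser (`CaseII.eq27_false_for_minimal`) and the factor
at a SINGLE Case II stage is false (`CaseII.factor_false_for_minimal`, the aligned regime) — there the next stage is
simply not Case II; the factor is recovered from Case II at the NEXT stage.

MECHANISM (quantitative form of the rigidity of `CaseIIRigidity.lean`; pure KKT, no Case II needed for the
identities).  With `w = ℓ'(T)y − y`, `w₁ = V_y(S(La)) = Σ_{j≥1} a_j T^j y` and the three "leak" terms
`E₁ = ⟨x₀ − y', V_{y'}(S(La))⟩`, `E₂ = ⟨x₀ − y, w₁⟩`, `E₃ = ⟨x₀ − y, T V_w(La)⟩` (all ZERO under exact Case II):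
`⟨w, T V_{w₁}(La)⟩ = C'a₀‖La‖² + E₃ − E₁ − (a₀ − 1)E₂` (`CaseII.tail_identity`) and
`‖w‖² = δ²‖y‖² − 2εθ(1 + δ − Re a₀) + 2 Re E₂` (`CaseII.norm_sq_displacement_eq_gen`).  Case II as printed plus
`|⟨x, T^j z⟩| ≤ ‖T‖^j ≤ 10^{−20j}` gives the ENVELOPE `|⟨x₀ − y, T^j y⟩| ≤ (εθ)³·10^{−5j}` (`CaseII.caseII_envelope`,
no fractional powers), whence `|E_i| ≤ 7·10⁻⁵·(εθ)³·‖La‖` (`Vy.norm_inner_V_le_of_orbit`,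
`CaseII.norm_inner_V_T_le`); the identity then forces `‖La‖ ≤ 1.5·10⁻⁴(εθ)²` (`CaseII.tail_inequality`),
`1 + δ − Re a₀ ≤ 10⁻¹²εθ`, and `(εθ)' = C'‖a‖² ≤ (1+δ)²·(εθ(1 − ‖y‖²/10) + 10⁻¹²εθ + 3·10⁻²⁴(εθ)²) ≤ 0.9491εθ`
using `‖y‖² ≥ 0.5098` (from `‖x₀ − y‖ ≤ 0.7`, `εθ ≤ 10⁻⁴`).  Every error term is RELATIVE to `εθ` (no absolute
floor), so the bound is uniform on `0 < εθ ≤ 10⁻⁴`; all arithmetic is `linarith` over explicitly supplied products.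
Origin: planner-b2b-enflo-1-g7-0 (F1 gen-7), 2026-08-18.
-/

noncomputable section

open scoped InnerProductSpace ENNReal
open Literature.Analysis.UnboundedOperators (inner_self_eq_coe_norm_sq)

namespace Literature.Analysis.OperatorTheory.Enflo2023

variable {H : Type*} [NormedAddCommGroup H] [InnerProductSpace ℂ H] [CompleteSpace H]

namespace Vy

/-! ### Geometric envelopes on the orbit transfer to `V_y` -/

/-- `V_{T^k y} b = T^k (V_y b)` (`V_apply_T`, iterated). [cite: Enflo2023, v2 p.2, eq. (2)] -/
theorem V_pow_base (T : H →L[ℂ] H) (hT : ‖T‖ < 1) (y : H) (b : ℓ2) (k : ℕ) :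
    V T hT ((T ^ k) y) b = (T ^ k) (V T hT y b) := by
  induction k with
  | zero => simp
  | succ k ih => rw [pow_succ', mul_apply_eq_comp, mul_apply_eq_comp, V_apply_T, ih]

/-- `Σ_j |c_j| ρ^j` converges for `c ∈ ℓ²`, `0 ≤ ρ < 1`. [folklore] -/
lemma summable_coeff_geom (c : ℓ2) {ρ : ℝ} (h0 : 0 ≤ ρ) (h1 : ρ < 1) :
    Summable (fun j => ‖c j‖ * ρ ^ j) := by
  have hg : Summable (fun j : ℕ => (‖c j‖ ^ 2 + (ρ ^ 2) ^ j) / 2) :=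
    ((summable_sq c).add (summable_geometric_of_lt_one (by positivity) (by nlinarith))).div_const 2
  refine Summable.of_nonneg_of_le (fun j => by positivity) (fun j => ?_) hg
  have := two_mul_le_add_sq ‖c j‖ (ρ ^ j)
  rw [← pow_mul, mul_comm 2 j, pow_mul]
  linarith

/-- Cauchy–Schwarz: `Σ_j |c_j| ρ^j ≤ ‖c‖ (1 − ρ²)^{-1/2}` (`0 ≤ ρ < 1`). [folklore] -/
lemma tsum_coeff_geom_le (c : ℓ2) {ρ : ℝ} (h0 : 0 ≤ ρ) (h1 : ρ < 1) :
    ∑' j, ‖c j‖ * ρ ^ j ≤ ‖c‖ * Real.sqrt (1 / (1 - ρ ^ 2)) := by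
  have hq2 : ρ ^ 2 < 1 := by nlinarith
  have hgeo : HasSum (fun j : ℕ => (ρ ^ 2) ^ j) (1 - ρ ^ 2)⁻¹ :=
    hasSum_geometric_of_lt_one (by positivity) hq2
  refine Real.tsum_le_of_sum_le (fun j => by positivity) (fun s => ?_)
  have hcs := Finset.sum_mul_sq_le_sq_mul_sq s (fun j => ‖c j‖) (fun j => ρ ^ j)
  have h1 : ∑ j ∈ s, (ρ ^ j) ^ 2 ≤ (1 - ρ ^ 2)⁻¹ := by
    have := sum_le_hasSum s (fun j _ => by positivity) hgeo
    refine le_trans (le_of_eq ?_) this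
    refine Finset.sum_congr rfl (fun j _ => ?_)
    rw [← pow_mul, mul_comm j 2, pow_mul]
  have h2 := sum_sq_le c s
  have hS0 : 0 ≤ ∑ j ∈ s, ‖c j‖ * ρ ^ j := Finset.sum_nonneg (fun j _ => by positivity)
  have hrhs : 0 ≤ ‖c‖ * Real.sqrt (1 / (1 - ρ ^ 2)) := by positivity
  have key : (∑ j ∈ s, ‖c j‖ * ρ ^ j) ^ 2 ≤ (‖c‖ * Real.sqrt (1 / (1 - ρ ^ 2))) ^ 2 := by
    rw [mul_pow, Real.sq_sqrt (by positivity), one_div]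
    calc (∑ j ∈ s, ‖c j‖ * ρ ^ j) ^ 2 ≤ (∑ j ∈ s, ‖c j‖ ^ 2) * ∑ j ∈ s, (ρ ^ j) ^ 2 := hcs
      _ ≤ ‖c‖ ^ 2 * (1 - ρ ^ 2)⁻¹ := by gcongr
  exact pow_le_pow_iff_left₀ hS0 hrhs (by norm_num : (2:ℕ) ≠ 0) |>.1 key

/-- **A geometric envelope on the orbit transfers to `V_y`**: if `|⟨x, T^j z⟩| ≤ M ρ^j` for all `j ≥ 0`
(`0 ≤ ρ < 1`), then `|⟨x, V_z c⟩| ≤ M (1 − ρ²)^{-1/2} ‖c‖` for every `c ∈ ℓ²`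
(`⟨x, V_z c⟩ = Σ_j c_j ⟨x, T^j z⟩` and Cauchy–Schwarz). [folklore] -/
theorem norm_inner_V_le_of_orbit (T : H →L[ℂ] H) (hT : ‖T‖ < 1) (x z : H) (c : ℓ2) {M ρ : ℝ}
    (hM : 0 ≤ M) (h0 : 0 ≤ ρ) (h1 : ρ < 1) (h : ∀ j : ℕ, ‖⟪x, (T ^ j) z⟫_ℂ‖ ≤ M * ρ ^ j) :
    ‖⟪x, V T hT z c⟫_ℂ‖ ≤ M * Real.sqrt (1 / (1 - ρ ^ 2)) * ‖c‖ := by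
  have h' : ∀ j, ‖c j * ⟪x, (T ^ j) z⟫_ℂ‖ ≤ M * (‖c j‖ * ρ ^ j) := by
    intro j
    rw [norm_mul]
    calc ‖c j‖ * ‖⟪x, (T ^ j) z⟫_ℂ‖ ≤ ‖c j‖ * (M * ρ ^ j) :=
          mul_le_mul_of_nonneg_left (h j) (norm_nonneg _)
      _ = M * (‖c j‖ * ρ ^ j) := by ring
  have hs : Summable (fun j => M * (‖c j‖ * ρ ^ j)) := (summable_coeff_geom c h0 h1).mul_left M
  have hs' : Summable (fun j => ‖c j * ⟪x, (T ^ j) z⟫_ℂ‖) :=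
    Summable.of_nonneg_of_le (fun j => norm_nonneg _) h' hs
  rw [inner_V_right]
  calc ‖∑' j, c j * ⟪x, (T ^ j) z⟫_ℂ‖ ≤ ∑' j, ‖c j * ⟪x, (T ^ j) z⟫_ℂ‖ := norm_tsum_le_tsum_norm hs'
    _ ≤ ∑' j, M * (‖c j‖ * ρ ^ j) := Summable.tsum_le_tsum h' hs' hs
    _ = M * ∑' j, ‖c j‖ * ρ ^ j := tsum_mul_left
    _ ≤ M * (‖c‖ * Real.sqrt (1 / (1 - ρ ^ 2))) :=
        mul_le_mul_of_nonneg_left (tsum_coeff_geom_le c h0 h1) hM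
    _ = M * Real.sqrt (1 / (1 - ρ ^ 2)) * ‖c‖ := by ring

end Vy

namespace CaseII

open Vy

/-! ### Case II as printed gives a geometric envelope (no fractional powers) -/

/-- `min(e⁴, ρ^{4j}) ≤ e³ρ^j`: if `r ≤ e⁴` and `r ≤ ρ^{4j}` (`r, e, ρ ≥ 0`) then `r ≤ e³ρ^j`. [folklore] -/
lemma envelope (r e ρ : ℝ) (j : ℕ) (he : 0 ≤ e) (hρ : 0 ≤ ρ) (h4 : r ≤ e ^ 4) (hq : r ≤ ρ ^ (4 * j)) :
    r ≤ e ^ 3 * ρ ^ j := by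
  rcases le_or_gt e (ρ ^ j) with h | h
  · calc r ≤ e ^ 4 := h4
      _ = e ^ 3 * e := by ring
      _ ≤ e ^ 3 * ρ ^ j := mul_le_mul_of_nonneg_left h (pow_nonneg he 3)
  · calc r ≤ ρ ^ (4 * j) := hq
      _ = (ρ ^ j) ^ 3 * ρ ^ j := by ring
      _ ≤ e ^ 3 * ρ ^ j :=
          mul_le_mul_of_nonneg_right (pow_le_pow_left₀ (pow_nonneg hρ j) h.le 3) (pow_nonneg hρ j)

omit [CompleteSpace H] in
/-- Orbit decay: `|⟨x, T^j z⟩| ≤ ‖T‖^j ≤ 10^{−20j} = (10⁻⁵)^{4j}` for `‖x‖, ‖z‖ ≤ 1`, `‖T‖ ≤ 10⁻²⁰`. [cite: Enflo2023, v2 p.12 ("`‖T‖_op = 1/K`, `K = 10²⁰`")] -/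
lemma norm_inner_orbit_le (T : H →L[ℂ] H) (hT : ‖T‖ ≤ 1 / 10 ^ 20) (x z : H) (hx : ‖x‖ ≤ 1)
    (hz : ‖z‖ ≤ 1) (j : ℕ) : ‖⟪x, (T ^ j) z⟫_ℂ‖ ≤ (1 / 10 ^ 5 : ℝ) ^ (4 * j) := by
  calc ‖⟪x, (T ^ j) z⟫_ℂ‖ ≤ ‖x‖ * ‖(T ^ j) z‖ := norm_inner_le_norm _ _
    _ ≤ 1 * (‖T‖ ^ j * ‖z‖) := by gcongr; exact norm_pow_apply_le T j z
    _ ≤ 1 * ((1 / 10 ^ 20) ^ j * 1) := by gcongr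
    _ = (1 / 10 ^ 5 : ℝ) ^ (4 * j) := by rw [pow_mul]; norm_num

omit [CompleteSpace H] in
/-- **Case II as printed ⟹ geometric envelope.**  If `|⟨x, T^j z⟩| ≤ e⁴` for all `j ≥ 1` (the text's Case II
at `z`, `e = εθ`), `‖x‖, ‖z‖ ≤ 1` and `‖T‖ ≤ 10⁻²⁰`, then `|⟨x, T^j(Tz)⟩| ≤ (e³·10⁻⁵)·(10⁻⁵)^j` for ALL
`j ≥ 0`. [cite: Enflo2023, v2 p.12, Case II (tex L400)] -/
theorem caseII_envelope (T : H →L[ℂ] H) (hT : ‖T‖ ≤ 1 / 10 ^ 20) (x z : H) (hx : ‖x‖ ≤ 1) (hz : ‖z‖ ≤ 1)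
    (e : ℝ) (he : 0 ≤ e) (hII : ∀ j, 1 ≤ j → ‖⟪x, (T ^ j) z⟫_ℂ‖ ≤ e ^ 4) (j : ℕ) :
    ‖⟪x, (T ^ j) (T z)⟫_ℂ‖ ≤ e ^ 3 * (1 / 10 ^ 5) * (1 / 10 ^ 5 : ℝ) ^ j := by
  have hTj : (T ^ j) (T z) = (T ^ (j + 1)) z := by rw [pow_succ, mul_apply_eq_comp]
  rw [hTj]
  have h := envelope _ e (1 / 10 ^ 5) (j + 1) he (by norm_num) (hII (j + 1) (by omega))
    (norm_inner_orbit_le T hT x z hx hz (j + 1))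
  calc ‖⟪x, (T ^ (j + 1)) z⟫_ℂ‖ ≤ e ^ 3 * (1 / 10 ^ 5 : ℝ) ^ (j + 1) := h
    _ = e ^ 3 * (1 / 10 ^ 5) * (1 / 10 ^ 5 : ℝ) ^ j := by ring

/-- The envelope, summed against `ℓ²` coefficients: under Case II as printed at `z` (`e = εθ`),
`|⟨x, V_{Tz} c⟩| ≤ 2·10⁻⁵·e³·‖c‖` for every `c ∈ ℓ²` (`(1 − 10⁻¹⁰)^{-1/2} ≤ 2`). [cite: Enflo2023, v2 p.12, Case II (tex L400)] -/
theorem norm_inner_V_T_le (T : H →L[ℂ] H) (hT1 : ‖T‖ < 1) (hT : ‖T‖ ≤ 1 / 10 ^ 20) (x z : H)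
    (hx : ‖x‖ ≤ 1) (hz : ‖z‖ ≤ 1) (e : ℝ) (he : 0 ≤ e) (hII : ∀ j, 1 ≤ j → ‖⟪x, (T ^ j) z⟫_ℂ‖ ≤ e ^ 4)
    (c : ℓ2) : ‖⟪x, V T hT1 (T z) c⟫_ℂ‖ ≤ 2 / 10 ^ 5 * e ^ 3 * ‖c‖ := by
  have hs : Real.sqrt (1 / (1 - (1 / 10 ^ 5 : ℝ) ^ 2)) ≤ 2 := by
    rw [show (2 : ℝ) = Real.sqrt (2 ^ 2) from (Real.sqrt_sq (by norm_num)).symm]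
    exact Real.sqrt_le_sqrt (by norm_num)
  have h := norm_inner_V_le_of_orbit T hT1 x (T z) c (by positivity : 0 ≤ e ^ 3 * (1 / 10 ^ 5 : ℝ))
    (by norm_num) (by norm_num) (caseII_envelope T hT x z hx hz e he hII)
  calc ‖⟪x, V T hT1 (T z) c⟫_ℂ‖ ≤ e ^ 3 * (1 / 10 ^ 5) * Real.sqrt (1 / (1 - (1 / 10 ^ 5 : ℝ) ^ 2)) * ‖c‖ := h
    _ ≤ e ^ 3 * (1 / 10 ^ 5) * 2 * ‖c‖ := by gcongr
    _ = 2 / 10 ^ 5 * e ^ 3 * ‖c‖ := by ring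

/-! ### The exact identities (pure KKT; no Case II) -/

/-- **Displacement energy, general form.**  For THE minimiser of (26) with `⟨x₀ − y, y⟩ = εθ` (activity
`‖x₀ − ℓ'(T)y‖ = ‖x₀ − (1+δ)y‖`): `‖ℓ'(T)y − y‖² = δ²‖y‖² − 2εθ(1 + δ − Re a₀) + 2 Re⟨x₀ − y, V_y(S(La))⟩`
(`V_y(S(La)) = Σ_{j≥1} a_j T^j y`; under exact Case II the last term vanishes: `norm_sq_displacement_eq`). [cite: Enflo2023, v2 p.13, eq. (26)] -/
theorem norm_sq_displacement_eq_gen (T : H →L[ℂ] H) (hT : ‖T‖ < 1) (x₀ y : H) (et : ℝ) (a : ℓ2)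
    (ht : ⟪x₀ - y, y⟫_ℂ = et) (hact : ‖x₀ - V T hT y a‖ = ‖x₀ - ((1 + et / 10 : ℝ) : ℂ) • y‖) :
    ‖V T hT y a - y‖ ^ 2 = (et / 10) ^ 2 * ‖y‖ ^ 2 - 2 * et * ((1 + et / 10) - (a 0).re)
      + 2 * (⟪x₀ - y, V T hT y (S (L a))⟫_ℂ).re := by
  have hre : (⟪x₀ - y, y⟫_ℂ).re = et := by rw [ht, Complex.ofReal_re]
  have hVa : V T hT y a = a 0 • y + V T hT y (S (L a)) := by rw [V_shift]; exact V_decomp T hT y a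
  have hw : (⟪x₀ - y, V T hT y a - y⟫_ℂ).re
      = ((a 0).re - 1) * et + (⟪x₀ - y, V T hT y (S (L a))⟫_ℂ).re := by
    rw [inner_sub_right, hVa, inner_add_right, inner_smul_right, ht]
    simp only [Complex.sub_re, Complex.add_re, Complex.mul_re, Complex.ofReal_re, Complex.ofReal_im,
      mul_zero, sub_zero]
    ring
  have h1 : ‖x₀ - V T hT y a‖ ^ 2
      = ‖x₀ - y‖ ^ 2 - 2 * (⟪x₀ - y, V T hT y a - y⟫_ℂ).re + ‖V T hT y a - y‖ ^ 2 := by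
    have h := norm_sub_sq (𝕜 := ℂ) (x₀ - y) (V T hT y a - y)
    rw [sub_sub_sub_cancel_right] at h
    simpa only [RCLike.re_to_complex] using h
  have h2 : ‖x₀ - ((1 + et / 10 : ℝ) : ℂ) • y‖ ^ 2
      = ‖x₀ - y‖ ^ 2 - 2 * (et / 10) * et + (et / 10) ^ 2 * ‖y‖ ^ 2 := by
    rw [Lemma1.norm_sub_add_smul_sq x₀ y (et / 10), hre]
  rw [hact, h2, hw] at h1
  linarith

/-- **The tail identity (pure KKT).**  Let `V_y†(x₀ − V_y a) = C'a` ((5)), `w = V_y a − y`,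
`w₁ = V_y(S(La))`, and `E₁ = ⟨x₀ − V_y a, V_{V_y a}(S(La))⟩`, `E₂ = ⟨x₀ − y, w₁⟩`, `E₃ = ⟨x₀ − y, T V_w(La)⟩`.
Then `⟨w, T V_{w₁}(La)⟩ = C'a₀‖La‖² + E₃ − E₁ − (a₀ − 1)E₂`.  (Ingredients: (5) on the range of `V_y`;
`V_{y+w} = V_y + V_w`, `V_w = (a₀−1)V_y + V_{w₁}`; under exact Case II at `y` and at `V_y a` all `E_i = 0`
and the identity is the rigidity `Z = C'a₀‖La‖²` of `CaseIIRigidity.lean`.) [cite: Enflo2023, v2 p.3, eq. (5); p.13, eq. (26)] -/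
theorem tail_identity (T : H →L[ℂ] H) (hT : ‖T‖ < 1) (x₀ y : H) (a : ℓ2) {C : ℝ}
    (hC : ContinuousLinearMap.adjoint (V T hT y) (x₀ - V T hT y a) = (C : ℂ) • a) :
    ⟪V T hT y a - y, T (V T hT (V T hT y (S (L a))) (L a))⟫_ℂ
      = (C : ℂ) * a 0 * ((‖L a‖ ^ 2 : ℝ) : ℂ)
        + ⟪x₀ - y, T (V T hT (V T hT y a - y) (L a))⟫_ℂ
        - ⟪x₀ - V T hT y a, V T hT (V T hT y a) (S (L a))⟫_ℂ
        - (a 0 - 1) * ⟪x₀ - y, V T hT y (S (L a))⟫_ℂ := by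
  set w : H := V T hT y a - y with hw_def
  set w₁ : H := V T hT y (S (L a)) with hw₁_def
  -- `⟪a, S(La)⟫ = ‖La‖²`
  have hSL : S (L a) = a - a 0 • (lp.single 2 0 (1 : ℂ) : ℓ2) := by
    refine lp.ext (funext fun n => ?_)
    rcases n with _ | n
    · simp [S_apply_zero]
    · simp [S_apply_succ, L_apply, lp.single_apply]
  have haS : ⟪a, S (L a)⟫_ℂ = ((‖L a‖ ^ 2 : ℝ) : ℂ) := by
    rw [hSL, inner_sub_right, inner_smul_right, inner_self_eq_coe_norm_sq, norm_L_apply_sq,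
      lp.inner_single_right, RCLike.inner_apply, one_mul, Complex.mul_conj, Complex.normSq_eq_norm_sq]
    push_cast; ring
  -- (F3) `⟪w, V_y r⟫ = ⟪x₀ − y, V_y r⟫ − C⟪a, r⟫`
  have hF3 : ∀ r : ℓ2, ⟪w, V T hT y r⟫_ℂ = ⟪x₀ - y, V T hT y r⟫_ℂ - C * ⟪a, r⟫_ℂ := by
    intro r
    have h1 : w = (x₀ - y) - (x₀ - V T hT y a) := by rw [hw_def]; abel
    rw [h1, inner_sub_left, IsMinimal.eq5 hC r]
  -- (I) `⟪w, w₁⟫ = E₂ − C‖La‖²`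
  have hI : ⟪w, w₁⟫_ℂ = ⟪x₀ - y, w₁⟫_ℂ - (C : ℂ) * ((‖L a‖ ^ 2 : ℝ) : ℂ) := by
    rw [hw₁_def, hF3, haS]
  have hw₁T : w₁ = T (V T hT y (L a)) := V_shift T hT y (L a)
  have hVa : V T hT y a = a 0 • y + w₁ := by rw [hw₁T]; exact V_decomp T hT y a
  have hbase : V T hT y a = y + w := by rw [hw_def]; abel
  have hw_eq : w = (a 0 - 1) • y + w₁ := by rw [hw_def, hVa, sub_smul, one_smul]; abel
  -- (II) expand `E₁` over `V_{y+w}(S La) = w₁ + T V_w(La)` and `x₀ − V a = (x₀ − y) − w`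
  have hexp : V T hT (V T hT y a) (S (L a)) = w₁ + T (V T hT w (L a)) := by
    rw [hbase, V_add_vec, V_shift T hT w (L a)]
  have hsub : x₀ - V T hT y a = (x₀ - y) - w := by rw [hw_def]; abel
  have hE1 : ⟪x₀ - V T hT y a, V T hT (V T hT y a) (S (L a))⟫_ℂ
      = ⟪x₀ - y, w₁⟫_ℂ + ⟪x₀ - y, T (V T hT w (L a))⟫_ℂ
        - (⟪w, w₁⟫_ℂ + ⟪w, T (V T hT w (L a))⟫_ℂ) := by
    rw [hexp, hsub, inner_sub_left, inner_add_right, inner_add_right]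
  -- (III) split `V_w = (a₀ − 1)V_y + V_{w₁}`
  have hVw : V T hT w (L a) = (a 0 - 1) • V T hT y (L a) + V T hT w₁ (L a) := by
    rw [hw_eq, V_add_vec, V_smul_vec]
  have hTVw : T (V T hT w (L a)) = (a 0 - 1) • w₁ + T (V T hT w₁ (L a)) := by
    rw [hVw, map_add, map_smul, ← hw₁T]
  have hZ : ⟪w, T (V T hT w₁ (L a))⟫_ℂ = ⟪w, T (V T hT w (L a))⟫_ℂ - (a 0 - 1) * ⟪w, w₁⟫_ℂ := by
    rw [hTVw, inner_add_right, inner_smul_right]; ring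
  rw [hZ]
  linear_combination hE1 - a 0 * hI

/-- **The tail inequality.**  In the notation of `tail_identity`, with `C' ≥ 0`:
`C'·Re a₀·‖La‖² ≤ ‖w‖·‖T‖²(1 − ‖T‖²)⁻¹‖y‖·‖La‖² + |E₃| + |E₁| + |a₀ − 1|·|E₂|`. [cite: Enflo2023, v2 p.3, eq. (5); p.13, eq. (26)] -/
theorem tail_inequality (T : H →L[ℂ] H) (hT : ‖T‖ < 1) (x₀ y : H) (a : ℓ2) {C : ℝ} (hC0 : 0 ≤ C)
    (hC : ContinuousLinearMap.adjoint (V T hT y) (x₀ - V T hT y a) = (C : ℂ) • a) :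
    C * (a 0).re * ‖L a‖ ^ 2
      ≤ ‖V T hT y a - y‖ * (‖T‖ ^ 2 * (1 / (1 - ‖T‖ ^ 2)) * ‖y‖) * ‖L a‖ ^ 2
        + ‖⟪x₀ - y, T (V T hT (V T hT y a - y) (L a))⟫_ℂ‖
        + ‖⟪x₀ - V T hT y a, V T hT (V T hT y a) (S (L a))⟫_ℂ‖
        + ‖a 0 - 1‖ * ‖⟪x₀ - y, V T hT y (S (L a))⟫_ℂ‖ := by
  have hid := tail_identity T hT x₀ y a hC
  set w : H := V T hT y a - y with hw_def
  set w₁ : H := V T hT y (S (L a)) with hw₁_def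
  set E₁ := ⟪x₀ - V T hT y a, V T hT (V T hT y a) (S (L a))⟫_ℂ
  set E₂ := ⟪x₀ - y, w₁⟫_ℂ
  set E₃ := ⟪x₀ - y, T (V T hT w (L a))⟫_ℂ
  set Z := ⟪w, T (V T hT w₁ (L a))⟫_ℂ
  have h1T : 0 ≤ 1 / (1 - ‖T‖ ^ 2) := div_nonneg zero_le_one (by nlinarith [norm_nonneg T])
  have hs2 : Real.sqrt (1 / (1 - ‖T‖ ^ 2)) ^ 2 = 1 / (1 - ‖T‖ ^ 2) := Real.sq_sqrt h1T
  have hVa : V T hT y a = a 0 • y + w₁ := by rw [hw₁_def, V_shift]; exact V_decomp T hT y a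
  have hw₁le : ‖w₁‖ ≤ ‖T‖ * (‖y‖ * Real.sqrt (1 / (1 - ‖T‖ ^ 2))) * ‖L a‖ := by
    have h := norm_V_sub_head_le T hT y a
    rwa [hVa, add_sub_cancel_left] at h
  have hZle : ‖Z‖ ≤ ‖w‖ * (‖T‖ ^ 2 * (1 / (1 - ‖T‖ ^ 2)) * ‖y‖) * ‖L a‖ ^ 2 := by
    calc ‖Z‖ ≤ ‖w‖ * ‖T (V T hT w₁ (L a))‖ := norm_inner_le_norm _ _
      _ ≤ ‖w‖ * (‖T‖ * ‖V T hT w₁ (L a)‖) := by gcongr; exact T.le_opNorm _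
      _ ≤ ‖w‖ * (‖T‖ * (‖w₁‖ * Real.sqrt (1 / (1 - ‖T‖ ^ 2)) * ‖L a‖)) := by
          gcongr; exact (V T hT w₁).le_of_opNorm_le (norm_V_le T hT w₁) (L a)
      _ ≤ ‖w‖ * (‖T‖ * ((‖T‖ * (‖y‖ * Real.sqrt (1 / (1 - ‖T‖ ^ 2))) * ‖L a‖)
            * Real.sqrt (1 / (1 - ‖T‖ ^ 2)) * ‖L a‖)) := by gcongr
      _ = ‖w‖ * (‖T‖ ^ 2 * Real.sqrt (1 / (1 - ‖T‖ ^ 2)) ^ 2 * ‖y‖) * ‖L a‖ ^ 2 := by ring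
      _ = ‖w‖ * (‖T‖ ^ 2 * (1 / (1 - ‖T‖ ^ 2)) * ‖y‖) * ‖L a‖ ^ 2 := by rw [hs2]
  have hmain : ‖(C : ℂ) * a 0 * ((‖L a‖ ^ 2 : ℝ) : ℂ)‖ ≤ ‖Z‖ + ‖E₃‖ + ‖E₁‖ + ‖a 0 - 1‖ * ‖E₂‖ := by
    have h : (C : ℂ) * a 0 * ((‖L a‖ ^ 2 : ℝ) : ℂ) = Z - E₃ + E₁ + (a 0 - 1) * E₂ := by
      rw [hid]; ring
    rw [h]
    calc ‖Z - E₃ + E₁ + (a 0 - 1) * E₂‖ ≤ ‖Z - E₃ + E₁‖ + ‖(a 0 - 1) * E₂‖ := norm_add_le _ _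
      _ ≤ ‖Z - E₃‖ + ‖E₁‖ + ‖(a 0 - 1) * E₂‖ := by gcongr; exact norm_add_le _ _
      _ ≤ ‖Z‖ + ‖E₃‖ + ‖E₁‖ + ‖(a 0 - 1) * E₂‖ := by gcongr; exact norm_sub_le _ _
      _ = ‖Z‖ + ‖E₃‖ + ‖E₁‖ + ‖a 0 - 1‖ * ‖E₂‖ := by rw [norm_mul]
  have hge : C * (a 0).re * ‖L a‖ ^ 2 ≤ ‖(C : ℂ) * a 0 * ((‖L a‖ ^ 2 : ℝ) : ℂ)‖ := by
    rw [norm_mul, norm_mul, Complex.norm_real, Complex.norm_real, Real.norm_of_nonneg hC0,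
      Real.norm_of_nonneg (sq_nonneg _)]
    have hre0 : (a 0).re ≤ ‖a 0‖ := le_trans (le_abs_self _) (Complex.abs_re_le_norm _)
    have := mul_le_mul_of_nonneg_left hre0 hC0
    exact mul_le_mul_of_nonneg_right this (sq_nonneg _)
  linarith [hge, hmain, hZle]

/-! ### The factor, under Case II as printed at two consecutive stages -/

/-- **The factor `(εθ)' < (1 − 1/20)εθ` holds whenever Case II (as printed) holds at `y` AND at `ℓ'(T)y`.**
`‖T‖ ≤ 10⁻²⁰`, `‖x₀‖ = 1`, `⟨x₀ − y, y⟩ = εθ ∈ (0, 10⁻⁴]`, `‖x₀ − y‖ ≤ 0.7`; `a` THE minimiser of (26),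
`y' = V_y a`, `(εθ)' = Re⟨x₀ − y', y'⟩ (= C'‖a‖²)`.  Case II as printed at `y`: `|⟨x₀ − y, T^j y⟩| ≤ (εθ)⁴`
(`j ≥ 1`); at `y'`: `|⟨x₀ − y', T^j y'⟩| ≤ ((εθ)')⁴` (`j ≥ 1`).  Conclusion: `(εθ)' ≤ 0.9491·εθ`.  (At a SINGLE
Case II stage this is false — `CaseII.factor_false_for_minimal`; the second Case II hypothesis is what the
text's "if Case II happens every time" supplies.) [cite: Enflo2023, v2 p.12 (Case II, tex L400); p.13, eq. (26)–(27), tex L421–L431] -/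
theorem factor_of_caseII_twice (T : H →L[ℂ] H) (hT1 : ‖T‖ < 1) (hT : ‖T‖ ≤ 1 / 10 ^ 20)
    (x₀ y : H) (et : ℝ) (a : ℓ2) (h0 : ‖x₀‖ = 1) (ht : ⟪x₀ - y, y⟫_ℂ = et) (het : 0 < et)
    (het1 : et ≤ 1 / 10 ^ 4) (hd : ‖x₀ - y‖ ≤ 0.7)
    (hII : ∀ j, 1 ≤ j → ‖⟪x₀ - y, (T ^ j) y⟫_ℂ‖ ≤ et ^ 4)
    (hmin : IsMinimal (V T hT1 y) x₀ ‖x₀ - ((1 + et / 10 : ℝ) : ℂ) • y‖ a)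
    (hII' : ∀ j, 1 ≤ j → ‖⟪x₀ - V T hT1 y a, (T ^ j) (V T hT1 y a)⟫_ℂ‖
      ≤ (⟪x₀ - V T hT1 y a, V T hT1 y a⟫_ℂ).re ^ 4) :
    (⟪x₀ - V T hT1 y a, V T hT1 y a⟫_ℂ).re ≤ 0.9491 * et := by
  -- the setting of (26)
  have hre : (⟪x₀ - y, y⟫_ℂ).re = et := by rw [ht, Complex.ofReal_re]
  have hy1 : ‖y‖ ≤ 1 := norm_move_le_one x₀ y h0 (by rw [hre]; exact het.le)
  have hY1 : ‖y‖ ^ 2 ≤ 1 := pow_le_one₀ (norm_nonneg y) hy1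
  have hysq : ‖y‖ ^ 2 = 1 - ‖x₀ - y‖ ^ 2 - 2 * et := by rw [norm_sq_move x₀ y h0, hre]
  have hY : 0.5098 ≤ ‖y‖ ^ 2 := by
    rw [hysq]; linarith only [mul_le_mul hd hd (norm_nonneg _) (by norm_num : (0:ℝ) ≤ 0.7), het1]
  have hd1 : ‖x₀ - y‖ ≤ 1 := by linarith only [hd]
  have hrad : ‖x₀ - ((1 + et / 10 : ℝ) : ℂ) • y‖ ≤ ‖x₀ - y‖ :=
    radius_le_norm_sub x₀ y et hre (by linarith only [hY1])
  have hrad1 : ‖x₀ - ((1 + et / 10 : ℝ) : ℂ) • y‖ < ‖x₀‖ := by rw [h0]; linarith only [hrad, hd]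
  have ha0 : a ≠ 0 := hmin.ne_zero hrad1
  obtain ⟨C, hC0, hC⟩ := hmin.kkt ha0
  have hact : ‖x₀ - V T hT1 y a‖ = ‖x₀ - ((1 + et / 10 : ℝ) : ℂ) • y‖ := hmin.norm_sub_eq hrad1
  have hna : ‖a‖ ≤ 1 + et / 10 := norm_minimal_le_of_smul_feasible T hT1 (by linarith only [het]) hmin le_rfl
  have ha0le : ‖a 0‖ ≤ ‖a‖ := lp.norm_apply_le_norm (by norm_num) a 0
  have hu : (a 0).re ≤ 1 + et / 10 :=
    le_trans (le_trans (le_abs_self _) (Complex.abs_re_le_norm _)) (le_trans ha0le hna)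
  have hβ0 : 0 ≤ 1 + et / 10 - (a 0).re := sub_nonneg.2 hu
  have hX0 : 0 ≤ ‖L a‖ := norm_nonneg _
  have hLa : ‖L a‖ ≤ ‖a‖ :=
    (pow_le_pow_iff_left₀ (norm_nonneg _) (norm_nonneg _) two_ne_zero).1
      (by rw [norm_L_apply_sq]; linarith only [sq_nonneg ‖a 0‖])
  have hna1 : ‖a‖ ≤ 1.00001 := by linarith only [hna, het1]
  have hX1 : ‖L a‖ ≤ 1.00001 := by linarith only [hLa, hna1]
  have hn0 : ‖a 0 - 1‖ ≤ 2.00001 := by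
    calc ‖a 0 - 1‖ ≤ ‖a 0‖ + ‖(1 : ℂ)‖ := norm_sub_le _ _
      _ ≤ 1.00001 + 1 := by rw [norm_one]; linarith only [ha0le, hna1]
      _ = 2.00001 := by norm_num
  have het3 : 0 ≤ et ^ 3 := pow_nonneg het.le 3
  have hp2 : et ^ 2 ≤ 1 / 10 ^ 4 * et := by
    calc et ^ 2 = et * et := by ring
      _ ≤ 1 / 10 ^ 4 * et := mul_le_mul_of_nonneg_right het1 het.le
  have hp3 : et ^ 3 ≤ 1 / 10 ^ 4 * et ^ 2 := by
    calc et ^ 3 = et * et ^ 2 := by ring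
      _ ≤ 1 / 10 ^ 4 * et ^ 2 := mul_le_mul_of_nonneg_right het1 (sq_nonneg _)
  have hp4 : et ^ 4 ≤ 1 / 10 ^ 4 * et ^ 3 := by
    calc et ^ 4 = et * et ^ 3 := by ring
      _ ≤ 1 / 10 ^ 4 * et ^ 3 := mul_le_mul_of_nonneg_right het1 het3
  -- the next stage: `(εθ)' = C‖a‖²` (real, `≥ 0`), `‖y'‖ ≤ 1`, `‖x₀ − y'‖ ≤ 1`
  have het' : ⟪x₀ - V T hT1 y a, V T hT1 y a⟫_ℂ = ((C * ‖a‖ ^ 2 : ℝ) : ℂ) := IsMinimal.eq6 hC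
  have het're : (⟪x₀ - V T hT1 y a, V T hT1 y a⟫_ℂ).re = C * ‖a‖ ^ 2 := by rw [het', Complex.ofReal_re]
  rw [het're] at hII' ⊢
  have het'0 : 0 ≤ C * ‖a‖ ^ 2 := mul_nonneg hC0 (sq_nonneg _)
  have hy'1 : ‖V T hT1 y a‖ ≤ 1 := norm_move_le_one x₀ _ h0 (by rw [het're]; exact het'0)
  have hxy'1 : ‖x₀ - V T hT1 y a‖ ≤ 1 := by rw [hact]; linarith only [hrad, hd]
  -- facts about THE minimiser taken from the tree, then names `w`, `w₁`
  have hdisp := norm_sq_displacement_eq_gen T hT1 x₀ y et a ht hact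
  have htail := tail_inequality T hT1 x₀ y a hC0 hC
  have hhead := mul_re_head_eq_sub T hT1 x₀ y et a hre hC
  have hw₁le' := norm_V_sub_head_le T hT1 y a
  rw [V_decomp T hT1 y a, add_sub_cancel_left, ← V_shift] at hw₁le'
  have hVa : V T hT1 y a = a 0 • y + V T hT1 y (S (L a)) := by rw [V_shift]; exact V_decomp T hT1 y a
  set w : H := V T hT1 y a - y with hw_def
  set w₁ : H := V T hT1 y (S (L a)) with hw₁_def
  have hw_eq : w = (a 0 - 1) • y + w₁ := by rw [hw_def, hVa, sub_smul, one_smul]; abel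
  -- constants of the text: `‖T‖ ≤ 10⁻²⁰`
  have hT2 : ‖T‖ ^ 2 ≤ 1 / 10 ^ 40 := by
    calc ‖T‖ ^ 2 ≤ (1 / 10 ^ 20) ^ 2 := pow_le_pow_left₀ (norm_nonneg _) hT 2
      _ = 1 / 10 ^ 40 := by norm_num
  have h1T0 : 0 < 1 - ‖T‖ ^ 2 := by linarith only [hT2]
  have h1T : 0 ≤ 1 / (1 - ‖T‖ ^ 2) := div_nonneg zero_le_one h1T0.le
  have h1T2 : 1 / (1 - ‖T‖ ^ 2) ≤ 2 := by rw [div_le_iff₀ h1T0]; linarith only [hT2]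
  have hsT : Real.sqrt (1 / (1 - ‖T‖ ^ 2)) ≤ 2 := by
    rw [show (2 : ℝ) = Real.sqrt (2 ^ 2) from (Real.sqrt_sq (by norm_num)).symm]
    exact Real.sqrt_le_sqrt (by linarith only [h1T2])
  have hfrac : ‖T‖ ^ 2 * (1 / (1 - ‖T‖ ^ 2)) ≤ 1 / 10 ^ 40 * 2 := mul_le_mul hT2 h1T2 h1T (by norm_num)
  have hW₁ : ‖w₁‖ ≤ 2 / 10 ^ 20 * ‖L a‖ := by
    calc ‖w₁‖ ≤ ‖T‖ * (‖y‖ * Real.sqrt (1 / (1 - ‖T‖ ^ 2))) * ‖L a‖ := hw₁le'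
      _ ≤ 1 / 10 ^ 20 * (1 * 2) * ‖L a‖ := by gcongr
      _ = 2 / 10 ^ 20 * ‖L a‖ := by ring
  -- the three leak terms
  have hE2 : ‖⟪x₀ - y, w₁⟫_ℂ‖ ≤ 2 / 10 ^ 5 * et ^ 3 * ‖L a‖ := by
    rw [hw₁_def, V_shift, ← V_apply_T]
    exact norm_inner_V_T_le T hT1 hT (x₀ - y) y hd1 hy1 et het.le hII (L a)
  have hE1 : ‖⟪x₀ - V T hT1 y a, V T hT1 (V T hT1 y a) (S (L a))⟫_ℂ‖
      ≤ 2 / 10 ^ 5 * (C * ‖a‖ ^ 2) ^ 3 * ‖L a‖ := by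
    rw [V_shift, ← V_apply_T]
    exact norm_inner_V_T_le T hT1 hT _ _ hxy'1 hy'1 _ het'0 hII' (L a)
  have hs5 : Real.sqrt (1 / (1 - (1 / 10 ^ 5 : ℝ) ^ 2)) ≤ 2 := by
    rw [show (2 : ℝ) = Real.sqrt (2 ^ 2) from (Real.sqrt_sq (by norm_num)).symm]
    exact Real.sqrt_le_sqrt (by norm_num)
  have hE3 : ‖⟪x₀ - y, T (V T hT1 w (L a))⟫_ℂ‖ ≤ 2 / 10 ^ 5 * et ^ 3 * (2 * ‖a‖ + 1) * ‖L a‖ := by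
    rw [← V_apply_T]
    have henv : ∀ j : ℕ, ‖⟪x₀ - y, (T ^ j) (T w)⟫_ℂ‖
        ≤ (et ^ 3 * (1 / 10 ^ 5) * (2 * ‖a‖ + 1)) * (1 / 10 ^ 5 : ℝ) ^ j := by
      intro j
      have hsplit : (T ^ j) (T w) = V T hT1 ((T ^ j) (T y)) a - (T ^ j) (T y) := by
        rw [hw_def, map_sub, map_sub, V_pow_base, V_apply_T]
      have hVb : ‖⟪x₀ - y, V T hT1 ((T ^ j) (T y)) a⟫_ℂ‖
          ≤ (et ^ 3 * (1 / 10 ^ 5) * (1 / 10 ^ 5 : ℝ) ^ j) * Real.sqrt (1 / (1 - (1 / 10 ^ 5 : ℝ) ^ 2))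
              * ‖a‖ := by
        refine norm_inner_V_le_of_orbit T hT1 (x₀ - y) ((T ^ j) (T y)) a (by positivity) (by norm_num)
          (by norm_num) fun i => ?_
        have hTi : (T ^ i) ((T ^ j) (T y)) = (T ^ (i + j)) (T y) := by rw [pow_add, mul_apply_eq_comp]
        rw [hTi]
        calc ‖⟪x₀ - y, (T ^ (i + j)) (T y)⟫_ℂ‖ ≤ et ^ 3 * (1 / 10 ^ 5) * (1 / 10 ^ 5 : ℝ) ^ (i + j) :=
              caseII_envelope T hT (x₀ - y) y hd1 hy1 et het.le hII (i + j)
          _ = et ^ 3 * (1 / 10 ^ 5) * (1 / 10 ^ 5 : ℝ) ^ j * (1 / 10 ^ 5 : ℝ) ^ i := by rw [pow_add]; ring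
      have hyj := caseII_envelope T hT (x₀ - y) y hd1 hy1 et het.le hII j
      rw [hsplit, inner_sub_right]
      calc ‖⟪x₀ - y, V T hT1 ((T ^ j) (T y)) a⟫_ℂ - ⟪x₀ - y, (T ^ j) (T y)⟫_ℂ‖
          ≤ ‖⟪x₀ - y, V T hT1 ((T ^ j) (T y)) a⟫_ℂ‖ + ‖⟪x₀ - y, (T ^ j) (T y)⟫_ℂ‖ := norm_sub_le _ _
        _ ≤ (et ^ 3 * (1 / 10 ^ 5) * (1 / 10 ^ 5 : ℝ) ^ j) * Real.sqrt (1 / (1 - (1 / 10 ^ 5 : ℝ) ^ 2)) * ‖a‖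
            + et ^ 3 * (1 / 10 ^ 5) * (1 / 10 ^ 5 : ℝ) ^ j := add_le_add hVb hyj
        _ ≤ (et ^ 3 * (1 / 10 ^ 5) * (1 / 10 ^ 5 : ℝ) ^ j) * 2 * ‖a‖
            + et ^ 3 * (1 / 10 ^ 5) * (1 / 10 ^ 5 : ℝ) ^ j := by gcongr
        _ = (et ^ 3 * (1 / 10 ^ 5) * (2 * ‖a‖ + 1)) * (1 / 10 ^ 5 : ℝ) ^ j := by ring
    have h := norm_inner_V_le_of_orbit T hT1 (x₀ - y) (T w) (L a) (by positivity) (by norm_num)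
      (by norm_num) henv
    calc ‖⟪x₀ - y, V T hT1 (T w) (L a)⟫_ℂ‖
        ≤ (et ^ 3 * (1 / 10 ^ 5) * (2 * ‖a‖ + 1)) * Real.sqrt (1 / (1 - (1 / 10 ^ 5 : ℝ) ^ 2)) * ‖L a‖ := h
      _ ≤ (et ^ 3 * (1 / 10 ^ 5) * (2 * ‖a‖ + 1)) * 2 * ‖L a‖ := by gcongr
      _ = 2 / 10 ^ 5 * et ^ 3 * (2 * ‖a‖ + 1) * ‖L a‖ := by ring
  -- (D1) the displacement is small: `‖w‖ ≤ 0.11εθ`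
  have hrE2 := abs_le.1 (le_trans (Complex.abs_re_le_norm _) hE2)
  have hq1 : (et / 10) ^ 2 * ‖y‖ ^ 2 ≤ (et / 10) ^ 2 * 1 := mul_le_mul_of_nonneg_left hY1 (sq_nonneg _)
  have hq2 : 0 ≤ et * (1 + et / 10 - (a 0).re) := mul_nonneg het.le hβ0
  have hq3 : 2 / 10 ^ 5 * et ^ 3 * ‖L a‖ ≤ 2 / 10 ^ 5 * et ^ 3 * 1.00001 :=
    mul_le_mul_of_nonneg_left hX1 (mul_nonneg (by norm_num) het3)
  have hW2 : ‖w‖ ^ 2 ≤ (0.11 * et) ^ 2 := by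
    rw [hdisp]; linarith only [hrE2.2, hq1, hq2, hq3, hp3, sq_nonneg et]
  have hW : ‖w‖ ≤ 0.11 * et := (pow_le_pow_iff_left₀ (norm_nonneg _) (by linarith only [het]) two_ne_zero).1 hW2
  have hW0 : 0 ≤ ‖w‖ := norm_nonneg _
  -- (D2) the head: `0.89εθ ≤ C·Re a₀ ≤ 1.11εθ`
  have hyw := abs_le.1 (le_trans (Complex.abs_re_le_norm _) (norm_inner_le_norm y w))
  have hyW : ‖y‖ * ‖w‖ ≤ 1 * (0.11 * et) := mul_le_mul hy1 hW hW0 zero_le_one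
  have hCu_lo : 0.89 * et ≤ C * (a 0).re := by rw [hhead]; linarith only [hyw.2, hyW]
  have hCu_hi : C * (a 0).re ≤ 1.11 * et := by rw [hhead]; linarith only [hyw.1, hyW]
  -- (D3) a priori `1 + δ − Re a₀ ≤ 0.0051εθ < δ`, so `Re a₀ ≥ 1` and `(εθ)' ≤ 1.12εθ`
  have hβδ : 1 + et / 10 - (a 0).re ≤ 0.0051 * et := by
    refine le_of_mul_le_mul_left ?_ (by linarith only [het] : 0 < 2 * et)
    linarith only [sq_nonneg ‖w‖, hdisp, hrE2.2, hq1, hq3, hp3, sq_nonneg et]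
  have hu1 : 1 ≤ (a 0).re := by linarith only [hβδ, het1, het]
  have hC_hi : C ≤ 1.11 * et := le_trans (le_mul_of_one_le_right hC0 hu1) hCu_hi
  have hna2 : ‖a‖ ^ 2 ≤ (1 + et / 10) ^ 2 := pow_le_pow_left₀ (norm_nonneg a) hna 2
  have hsq1 : (1 + et / 10) ^ 2 ≤ 1.000021 := by
    linarith only [mul_le_mul het1 het1 het.le (by norm_num : (0:ℝ) ≤ 1 / 10 ^ 4), het1, het]
  have het'hi : C * ‖a‖ ^ 2 ≤ 1.12 * et := by
    calc C * ‖a‖ ^ 2 ≤ C * (1 + et / 10) ^ 2 := mul_le_mul_of_nonneg_left hna2 hC0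
      _ ≤ (1.11 * et) * 1.000021 := mul_le_mul hC_hi hsq1 (sq_nonneg _) (by linarith only [het])
      _ ≤ 1.12 * et := by linarith only [het]
  have het'3 : (C * ‖a‖ ^ 2) ^ 3 ≤ (1.12 * et) ^ 3 := pow_le_pow_left₀ het'0 het'hi 3
  -- (D5) the tail inequality forces `‖La‖ ≤ 1.5·10⁻⁴(εθ)²`
  have hp1 : 0.89 * et * ‖L a‖ ^ 2 ≤ C * (a 0).re * ‖L a‖ ^ 2 := mul_le_mul_of_nonneg_right hCu_lo (sq_nonneg _)
  have hpz : ‖w‖ * (‖T‖ ^ 2 * (1 / (1 - ‖T‖ ^ 2)) * ‖y‖) * ‖L a‖ ^ 2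
      ≤ (0.11 * et) * (1 / 10 ^ 40 * 2 * 1) * ‖L a‖ ^ 2 := by
    refine mul_le_mul_of_nonneg_right ?_ (sq_nonneg _)
    refine mul_le_mul hW ?_ (mul_nonneg (mul_nonneg (sq_nonneg _) h1T) (norm_nonneg _)) (by linarith only [het])
    exact mul_le_mul hfrac hy1 (norm_nonneg _) (by norm_num)
  have hpE3 : 2 / 10 ^ 5 * et ^ 3 * (2 * ‖a‖ + 1) * ‖L a‖ ≤ 2 / 10 ^ 5 * et ^ 3 * 3.00002 * ‖L a‖ :=
    mul_le_mul_of_nonneg_right (mul_le_mul_of_nonneg_left (by linarith only [hna1]) (mul_nonneg (by norm_num) het3)) hX0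
  have hpE1 : 2 / 10 ^ 5 * (C * ‖a‖ ^ 2) ^ 3 * ‖L a‖ ≤ 2 / 10 ^ 5 * (1.12 * et) ^ 3 * ‖L a‖ :=
    mul_le_mul_of_nonneg_right (mul_le_mul_of_nonneg_left het'3 (by norm_num)) hX0
  have hpE2 : ‖a 0 - 1‖ * ‖⟪x₀ - y, w₁⟫_ℂ‖ ≤ 2.00001 * (2 / 10 ^ 5 * et ^ 3 * ‖L a‖) :=
    mul_le_mul hn0 hE2 (norm_nonneg _) (by norm_num)
  have hp0 : 0 ≤ et * ‖L a‖ ^ 2 := mul_nonneg het.le (sq_nonneg _)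
  have hp00 : 0 ≤ et ^ 3 * ‖L a‖ := mul_nonneg het3 hX0
  have hq : et * (0.88 * ‖L a‖ ^ 2) ≤ et * (1.3 / 10 ^ 4 * et ^ 2 * ‖L a‖) := by
    linarith only [htail, hp1, hpz, hpE3, hpE1, hpE2, hE3, hE1, hp0, hp00]
  have hq' : 0.88 * ‖L a‖ ^ 2 ≤ 1.3 / 10 ^ 4 * et ^ 2 * ‖L a‖ := le_of_mul_le_mul_left hq het
  have hX : ‖L a‖ ≤ 1.5 / 10 ^ 4 * et ^ 2 := by
    rcases hX0.eq_or_lt with hX00 | hXpos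
    · rw [← hX00]; positivity
    · have h : ‖L a‖ * (0.88 * ‖L a‖) ≤ ‖L a‖ * (1.3 / 10 ^ 4 * et ^ 2) := by linarith only [hq']
      have := le_of_mul_le_mul_left h hXpos
      linarith only [this, sq_nonneg et]
  have hW₁' : ‖w₁‖ ≤ 3 / 10 ^ 24 * et ^ 2 := by linarith only [hW₁, hX]
  have hW₁0 : 0 ≤ ‖w₁‖ := norm_nonneg _
  -- (D8) the scaling is exhausted up to `10⁻¹²εθ`: `1 + δ − Re a₀ ≤ 10⁻¹²εθ`
  have hn0y : ‖a 0 - 1‖ * ‖y‖ ≤ ‖w‖ + ‖w₁‖ := by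
    have h : (a 0 - 1) • y = w - w₁ := by rw [hw_eq]; abel
    rw [← norm_smul, h]; exact norm_sub_le _ _
  have hp6 : ((a 0).re - 1) ^ 2 ≤ ‖a 0 - 1‖ ^ 2 := by
    have h := Complex.abs_re_le_norm (a 0 - 1)
    rw [Complex.sub_re, Complex.one_re] at h
    rw [← sq_abs]; exact pow_le_pow_left₀ (abs_nonneg _) h 2
  have hp7 : (‖a 0 - 1‖ * ‖y‖) ^ 2 ≤ (‖w‖ + ‖w₁‖) ^ 2 := pow_le_pow_left₀ (by positivity) hn0y 2
  have hp67 : ((a 0).re - 1) ^ 2 * ‖y‖ ^ 2 ≤ (‖w‖ + ‖w₁‖) ^ 2 :=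
    le_trans (mul_le_mul_of_nonneg_right hp6 (sq_nonneg _)) (by rw [← mul_pow]; exact hp7)
  have hF4 : (⟪y, w⟫_ℂ).re = ((a 0).re - 1) * ‖y‖ ^ 2 + (⟪y, w₁⟫_ℂ).re := by
    rw [hw_eq, inner_add_right, inner_smul_right, inner_self_eq_coe_norm_sq]
    simp only [Complex.add_re, Complex.mul_re, Complex.ofReal_re, Complex.ofReal_im, Complex.sub_re,
      Complex.one_re, Complex.sub_im, Complex.one_im, mul_zero, sub_zero]
  have hyw1 := abs_le.1 (le_trans (Complex.abs_re_le_norm _) (norm_inner_le_norm y w₁))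
  have hyW1 : ‖y‖ * ‖w₁‖ ≤ 1 * ‖w₁‖ := mul_le_mul_of_nonneg_right hy1 hW₁0
  have hβ2Y : 0 ≤ (1 + et / 10 - (a 0).re) ^ 2 * ‖y‖ ^ 2 := mul_nonneg (sq_nonneg _) (sq_nonneg _)
  have hrE2n : (⟪x₀ - y, w₁⟫_ℂ).re ≤ ‖⟪x₀ - y, w₁⟫_ℂ‖ :=
    le_trans (le_abs_self _) (Complex.abs_re_le_norm _)
  have hβmain : et * (1 + et / 10 - (a 0).re) * (2 - 0.2 * ‖y‖ ^ 2)
      ≤ 2 * ‖⟪x₀ - y, w₁⟫_ℂ‖ + 2 * ‖w‖ * ‖w₁‖ + ‖w₁‖ ^ 2 := by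
    linarith only [hdisp, hp67, hrE2n, hβ2Y]
  have hr1 : 2 * ‖⟪x₀ - y, w₁⟫_ℂ‖ ≤ 2 * (2 / 10 ^ 5 * et ^ 3 * (1.5 / 10 ^ 4 * et ^ 2)) := by
    have := mul_le_mul_of_nonneg_left hX (mul_nonneg (by norm_num : (0:ℝ) ≤ 2 / 10 ^ 5) het3)
    linarith only [this, hE2]
  have hr2 : 2 * ‖w‖ * ‖w₁‖ ≤ 2 * (0.11 * et) * (3 / 10 ^ 24 * et ^ 2) := by
    have := mul_le_mul hW hW₁' hW₁0 (by linarith only [het])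
    linarith only [this]
  have hr3 : ‖w₁‖ ^ 2 ≤ (3 / 10 ^ 24 * et ^ 2) ^ 2 := pow_le_pow_left₀ hW₁0 hW₁' 2
  have hlow : et * (1 + et / 10 - (a 0).re) * 1.8 ≤ et * (1 + et / 10 - (a 0).re) * (2 - 0.2 * ‖y‖ ^ 2) :=
    mul_le_mul_of_nonneg_left (by linarith only [hY1]) hq2
  have hp5 : et ^ 5 ≤ 1 / 10 ^ 4 * et ^ 4 := by
    calc et ^ 5 = et * et ^ 4 := by ring
      _ ≤ 1 / 10 ^ 4 * et ^ 4 := mul_le_mul_of_nonneg_right het1 (by positivity)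
  have hβZ : et * (1.8 * (1 + et / 10 - (a 0).re) - 1 / 10 ^ 12 * et) ≤ 0 := by
    linarith only [hβmain, hr1, hr2, hr3, hlow, hp3, hp4, hp5, sq_nonneg et]
  have hβ : 1.8 * (1 + et / 10 - (a 0).re) - 1 / 10 ^ 12 * et ≤ 0 :=
    not_lt.1 fun hcon => by linarith only [mul_pos het hcon, hβZ]
  -- (D9) assembly: `(εθ)' = C‖a‖² ≤ C(1+δ)²`, `C ≤ C·Re a₀ = εθ − Re⟨y, w⟩ ≤ εθ(1 − ‖y‖²/10) + β + ‖w₁‖`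
  have hCB : C ≤ 0.949021 * et := by
    have h1 : C ≤ C * (a 0).re := le_mul_of_one_le_right hC0 hu1
    have h2 : 0.1 * et * 0.5098 ≤ 0.1 * et * ‖y‖ ^ 2 := mul_le_mul_of_nonneg_left hY (by linarith only [het])
    have h3 : (1 + et / 10 - (a 0).re) * ‖y‖ ^ 2 ≤ (1 + et / 10 - (a 0).re) * 1 :=
      mul_le_mul_of_nonneg_left hY1 hβ0
    rw [hhead, hF4] at h1
    linarith only [h1, h2, h3, hyw1.1, hyW1, hW₁', hβ, hp2, het]
  calc C * ‖a‖ ^ 2 ≤ C * (1 + et / 10) ^ 2 := mul_le_mul_of_nonneg_left hna2 hC0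
    _ ≤ (0.949021 * et) * 1.000021 := mul_le_mul hCB hsq1 (sq_nonneg _) (by linarith only [het])
    _ ≤ 0.9491 * et := by linarith only [het]

/-- The factor in the text's form `(εθ)' ≤ (1 − 1/20)εθ`, and `(εθ)' < εθ`. [cite: Enflo2023, v2 p.13, tex L421–L431] -/
theorem factor_of_caseII_twice' (T : H →L[ℂ] H) (hT1 : ‖T‖ < 1) (hT : ‖T‖ ≤ 1 / 10 ^ 20)
    (x₀ y : H) (et : ℝ) (a : ℓ2) (h0 : ‖x₀‖ = 1) (ht : ⟪x₀ - y, y⟫_ℂ = et) (het : 0 < et)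
    (het1 : et ≤ 1 / 10 ^ 4) (hd : ‖x₀ - y‖ ≤ 0.7)
    (hII : ∀ j, 1 ≤ j → ‖⟪x₀ - y, (T ^ j) y⟫_ℂ‖ ≤ et ^ 4)
    (hmin : IsMinimal (V T hT1 y) x₀ ‖x₀ - ((1 + et / 10 : ℝ) : ℂ) • y‖ a)
    (hII' : ∀ j, 1 ≤ j → ‖⟪x₀ - V T hT1 y a, (T ^ j) (V T hT1 y a)⟫_ℂ‖
      ≤ (⟪x₀ - V T hT1 y a, V T hT1 y a⟫_ℂ).re ^ 4) :
    (⟪x₀ - V T hT1 y a, V T hT1 y a⟫_ℂ).re ≤ (1 - 1 / 20) * et ∧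
      (⟪x₀ - V T hT1 y a, V T hT1 y a⟫_ℂ).re < et := by
  have h := factor_of_caseII_twice T hT1 hT x₀ y et a h0 ht het het1 hd hII hmin hII'
  constructor <;> linarith

/-! ### The Case II branch of Part A along a run: the repaired conclusion -/

/-- **Part A, Case II branch — the conclusion holds (kernel-checked), although the printed inference does not.**
`‖T‖ ≤ 10⁻²⁰`, `‖x₀‖ = 1`, `y₀` in the window `0.3 ≤ ‖x₀ − y₀‖ ≤ 0.7`, `⟨x₀ − y₀, y₀⟩ = (εθ)₀ ∈ [0, 10⁻⁴]` real.
If along every iteration of (26) started at `y₀` (`y_{n+1} = ℓ'(T)y_n`, THE minimal solution) Case II AS PRINTED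
holds at every stage — `|⟨x₀ − y_n, T^j y_n⟩| ≤ (εθ_n)⁴` for `j ≥ 1` — then `T` has a non-trivial closed invariant
subspace.  Proof: a stage with `εθ_n = 0` is orthogonal to the whole orbit of `y_n ≠ 0`; otherwise
`factor_of_caseII_twice` gives `(εθ)_{n+1} ≤ 0.9491(εθ)_n` at every stage and `CaseII.crun_limit` produces the limit
`y` with `x₀ − y ⟂ T^j y`.  The manuscript's route to the same factor — "(27) gives `(εθ)' < εθ(1 − 1/20)`" — is
refuted for THE minimiser (`CaseII.eq27_false_for_minimal`, `CaseII.factor_false_for_minimal`); the factor is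
recovered here from Case II at the NEXT stage instead. [cite: Enflo2023, v2 p.12 (Case II, tex L400); p.13, eq. (26)–(27), tex L421–L431; Theorem 1] -/
theorem hasNontrivialClosedInvariantSubspace_of_caseII_along_runs (T : H →L[ℂ] H) (hT : ‖T‖ < 1)
    (hT20 : ‖T‖ ≤ 1 / 10 ^ 20) (x₀ y₀ : H) (hx₀ : ‖x₀‖ = 1)
    (hwin : 0.3 ≤ ‖x₀ - y₀‖ ∧ ‖x₀ - y₀‖ ≤ 0.7) (him : (⟪x₀ - y₀, y₀⟫_ℂ).im = 0)
    (ht0 : 0 ≤ (⟪x₀ - y₀, y₀⟫_ℂ).re) (ht1 : (⟪x₀ - y₀, y₀⟫_ℂ).re ≤ 1 / 10 ^ 4)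
    (hII : ∀ (y : ℕ → H) (a : ℕ → ℓ2), y 0 = y₀ →
      (∀ n, IsMinimal (V T hT (y n)) x₀ ‖x₀ - ((1 + (⟪x₀ - y n, y n⟫_ℂ).re / 10 : ℝ) : ℂ) • y n‖ (a n) ∧
        y (n + 1) = V T hT (y n) (a n)) →
      ∀ n j, 1 ≤ j → ‖⟪x₀ - y n, (T ^ j) (y n)⟫_ℂ‖ ≤ (⟪x₀ - y n, y n⟫_ℂ).re ^ 4) :
    HasNontrivialClosedInvariantSubspace T := by
  obtain ⟨y, a, hy0, hrun⟩ := exists_run T hT x₀ y₀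
  subst hy0
  have hCII := hII y a rfl hrun
  -- (S) along the run: `εθ_n ≥ 0` real, `‖x₀ − y_n‖ ≤ 0.7` (activity of the norm constraint), no Case II needed
  have hS : ∀ n, 0 ≤ (⟪x₀ - y n, y n⟫_ℂ).re ∧ ‖x₀ - y n‖ ≤ 0.7 ∧ (⟪x₀ - y n, y n⟫_ℂ).im = 0 := by
    intro n
    induction n with
    | zero => exact ⟨ht0, hwin.2, him⟩
    | succ m ih =>
      obtain ⟨hm0, hmd, -⟩ := ih
      have hy1 : ‖y m‖ ≤ 1 := norm_move_le_one x₀ (y m) hx₀ hm0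
      have hY1 : ‖y m‖ ^ 2 ≤ 1 := pow_le_one₀ (norm_nonneg _) hy1
      have hrad : ‖x₀ - ((1 + (⟪x₀ - y m, y m⟫_ℂ).re / 10 : ℝ) : ℂ) • y m‖ ≤ ‖x₀ - y m‖ :=
        radius_le_norm_sub x₀ (y m) _ rfl (by linarith only [hY1])
      have hrad1 : ‖x₀ - ((1 + (⟪x₀ - y m, y m⟫_ℂ).re / 10 : ℝ) : ℂ) • y m‖ < ‖x₀‖ := by
        rw [hx₀]; linarith only [hrad, hmd]
      obtain ⟨C, hC0, hC⟩ := (hrun m).1.kkt ((hrun m).1.ne_zero hrad1)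
      have h6 := IsMinimal.eq6 hC
      rw [(hrun m).2, h6, Complex.ofReal_re, Complex.ofReal_im, (hrun m).1.norm_sub_eq hrad1]
      exact ⟨mul_nonneg hC0 (sq_nonneg _), le_trans hrad hmd, rfl⟩
  have ht_re : ∀ n, ⟪x₀ - y n, y n⟫_ℂ = (((⟪x₀ - y n, y n⟫_ℂ).re : ℝ) : ℂ) := fun n =>
    Complex.ext (by rw [Complex.ofReal_re]) (by rw [Complex.ofReal_im]; exact (hS n).2.2)
  -- (R) `x₀ ≠ y_n` along the run (else the radius of the previous stage vanishes, forcing `εθ = 0` and `x₀ = y`)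
  have hR : ∀ n, x₀ - y n ≠ 0 := by
    intro n
    induction n with
    | zero =>
      intro h
      have : ‖x₀ - y 0‖ = 0 := by rw [h, norm_zero]
      linarith only [hwin.1, this]
    | succ m ih =>
      intro h
      obtain ⟨hm0, hmd, -⟩ := hS m
      have hminm := (hrun m).1
      have hy1 : ‖y m‖ ≤ 1 := norm_move_le_one x₀ (y m) hx₀ hm0
      have hY1 : ‖y m‖ ^ 2 ≤ 1 := pow_le_one₀ (norm_nonneg _) hy1
      generalize ht : (⟪x₀ - y m, y m⟫_ℂ).re = t at hminm hm0
      have hrad : ‖x₀ - ((1 + t / 10 : ℝ) : ℂ) • y m‖ ≤ ‖x₀ - y m‖ :=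
        radius_le_norm_sub x₀ (y m) t ht (by linarith only [hY1])
      have hrad1 : ‖x₀ - ((1 + t / 10 : ℝ) : ℂ) • y m‖ < ‖x₀‖ := by rw [hx₀]; linarith only [hrad, hmd]
      have hact := hminm.norm_sub_eq hrad1
      rw [← (hrun m).2, h, norm_zero] at hact
      have hx : x₀ = ((1 + t / 10 : ℝ) : ℂ) • y m := sub_eq_zero.1 (norm_eq_zero.1 hact.symm)
      have hxy : x₀ - y m = ((t / 10 : ℝ) : ℂ) • y m := by
        rw [hx, show ((1 + t / 10 : ℝ) : ℂ) = 1 + ((t / 10 : ℝ) : ℂ) by push_cast; ring, add_smul, one_smul,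
          add_sub_cancel_left]
      have key : t / 10 * ‖y m‖ ^ 2 = t := by
        have h1 := ht
        rw [hxy, inner_smul_left, inner_self_eq_coe_norm_sq, Complex.conj_ofReal, ← Complex.ofReal_mul,
          Complex.ofReal_re] at h1
        exact h1
      have hle : t / 10 * ‖y m‖ ^ 2 ≤ t / 10 * 1 := mul_le_mul_of_nonneg_left hY1 (by linarith only [hm0])
      have ht0' : t = 0 := by linarith only [key, hle, hm0]
      apply ih
      rw [hxy, ht0']; simp
  by_cases hpos : ∀ n, 0 < (⟪x₀ - y n, y n⟫_ℂ).re
  · -- every stage has `εθ_n > 0`: the factor holds at every stage, and `crun_limit` applies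
    have hfac : ∀ n, (⟪x₀ - y n, y n⟫_ℂ).re ≤ 1 / 10 ^ 4 →
        (⟪x₀ - y (n + 1), y (n + 1)⟫_ℂ).re ≤ 0.9491 * (⟪x₀ - y n, y n⟫_ℂ).re := by
      intro n hn
      have hII' : ∀ j, 1 ≤ j → ‖⟪x₀ - V T hT (y n) (a n), (T ^ j) (V T hT (y n) (a n))⟫_ℂ‖
          ≤ (⟪x₀ - V T hT (y n) (a n), V T hT (y n) (a n)⟫_ℂ).re ^ 4 := by
        intro j hj; have := hCII (n + 1) j hj; rwa [(hrun n).2] at this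
      have h := factor_of_caseII_twice T hT hT20 x₀ (y n) _ (a n) hx₀ (ht_re n) (hpos n) hn (hS n).2.1
        (hCII n) (hrun n).1 hII'
      rwa [(hrun n).2]
    have hsmall : ∀ n, (⟪x₀ - y n, y n⟫_ℂ).re ≤ 1 / 10 ^ 4 := by
      intro n
      induction n with
      | zero => exact ht1
      | succ m ih => linarith only [hfac m ih, (hpos m).le, ih]
    have hc : ∀ n, (⟪x₀ - y (n + 1), y (n + 1)⟫_ℂ).re ≤ (19 / 20) * (⟪x₀ - y n, y n⟫_ℂ).re := fun n => by
      linarith only [hfac n (hsmall n), (hpos n).le]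
    obtain ⟨ylim, -, -, -, hne, hsub, horth⟩ := crun_limit T hT hT20 x₀ y a (fun n => (⟪x₀ - y n, y n⟫_ℂ).re)
      (19 / 20) hx₀ (fun n => rfl) ht0 ht1 (by norm_num) (by norm_num)
      (by nlinarith [mul_le_mul ht1 ht1 ht0 (by norm_num : (0:ℝ) ≤ 1 / 10 ^ 4)]) hwin (fun n => (hrun n).1)
      (fun n => (hrun n).2) hc
    exact hasNontrivialClosedInvariantSubspace_of_orbit_orthogonal' T hne hsub horth
  · -- a stage with `εθ_n = 0`: `x₀ − y_n` is orthogonal to the whole orbit of `y_n`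
    obtain ⟨n, hn⟩ := not_forall.1 hpos
    have htn : (⟪x₀ - y n, y n⟫_ℂ).re = 0 := le_antisymm (not_lt.1 hn) (hS n).1
    have hyn : y n ≠ 0 := ne_zero_of_norm_sub_lt_one hx₀ (by linarith only [(hS n).2.1])
    have horth : ∀ j, ⟪x₀ - y n, (T ^ j) (y n)⟫_ℂ = 0 := by
      intro j
      rcases Nat.eq_zero_or_pos j with hj | hj
      · subst hj; rw [pow_zero, one_apply_eq_self, ht_re n, htn, Complex.ofReal_zero]
      · have h := hCII n j hj
        rw [htn] at h
        simpa using h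
    exact hasNontrivialClosedInvariantSubspace_of_orbit_orthogonal' T hyn (hR n) horth

end CaseII

end Literature.Analysis.OperatorTheory.Enflo2023
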